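import Summits.CriticalPhenomena.SAWScalingLimit.Theorems.SAWDevelopingMapHexConjectureKPGlueA
import Summits.CriticalPhenomena.SAWScalingLimit.Theorems.SAWDevelopingMapHexConjectureKPCrossings
import HarnessLib

/-!
# Crux `HexConjecture` (stmt-CriticalPhenomena-0808), line `root-locality-replaces-loewner`:
Krachun–Panagiotis, Lemma 3.2 — the counting step of construction (a)

Landing target:
`Summits/CriticalPhenomena/SAWScalingLimit/Theorems/SAWDevelopingMapHexConjectureKPCountA.lean`
(`--supports stmt-CriticalPhenomena-0808`; registered stub `stub_kp_countA`).

Krachun–Panagiotis (arXiv:2310.17299, proof of Lemma 3.2, eq. (9)): "concatenating a walk contributing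
to `D^{ren}_{2k+1}(x)` with a walk contributing to `F^B_{2i_x+1,x}` results in a walk that contributes to
`Σ_ℓ G_ℓ` … let `(γ¹, γ²)` be a pre-image of `γ` with `k ∈ [T, 2T-1]` maximal among the pre-images.
Then any other pre-image corresponds to a renewal time of `γ¹`, and the number of renewal times of `γ¹`
is at most `M_k`; by the multivalued map principle
`Σ_k Σ_x D^{ren}_{2k+1}(x) F^B_{2i_x+1,x} ≤ (max_k M_k) · Σ_ℓ G_ℓ`."

In the coordinate model `HV` of the tree: the triples `(k, P₁, P₂)` — `k ∈ [T, 2T)`, `P₁` a right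
exit of `T_k` with at most `renCap k` renewal times and a good exit height `h`, `P₂` a cut exit of the
clipped triangle `C(i_h, h)` — are glued by construction (a) (`stub_kp_glueA`,
`P₁ ++ (P₂.map (attach x₀ x₁)).drop 2`, the placement read off the final dart
`((x₀,x₁,false), (x₀,x₁,true))` of `P₁`) into floor arches of the Duminil-Copin–Smirnov trapezoid
`S_{32T+1,32T+1}` at offsets `d ∈ [T+1, 7T]`, the `x_c`-weights multiplying (`kpCount_lhs_eq`,
`kpCount_mapsTo`).  Every list has at most `M` pre-images (`kpCount_fibre_le`): for a fixed `k` the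
two pieces are read off the glued list (`kpCount_prefix_eq`: the first piece is the prefix up to the
first vertex beyond the line `slev = k ∣ k+1`; `kpCount_piece₂_eq`: the second is recovered by
injectivity of the placement), and two pre-images with indices `k' ≤ k` force `k'` to be a renewal
time of the first piece of the `k` pre-image (`kpCount_crossCount_eq_one`, from the crossing lemmas of
`…KPCrossings.lean`).  The multivalued map principle (`kpCount_sum_le_mul_sum`) then gives the
registered inequality `stub_kp_countA` (with the factor `1 + M ≥ M ≥ 0`).  No new definitions: the
domain of triples is the iterated `Finset.sigma` of the left-hand side, the target the `Finset.sigma`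
of the right-hand side.
Sources: KrachunPanagiotis2026 (§3.1–3.2, Lemma 3.2); GlazmanManolescu2019 (§4.1);
DuminilCopinSmirnov2012 (§3).
-/

noncomputable section

open scoped Classical
open Finset
open Literature.Probability.RandomPlanarGeometry.SAW Literature.Probability.RandomPlanarGeometry.SAW.HV

namespace Summit.CriticalPhenomena.SAWScalingLimit.Theorems.HexConjecture.RootLocality

/-! ### The multivalued map principle -/

/-- **The multivalued map principle** (weighted form): if `f` maps `s` into `t` with fibres of at
most `M` elements and the weights on `t` are nonnegative, then `Σ_{a ∈ s} w (f a) ≤ M · Σ_{b ∈ t} w b`.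
[cite: KrachunPanagiotis2026, proof of Lemma 3.2 ("by the multivalued map principle")] -/
theorem kpCount_sum_le_mul_sum {ι κ : Type*} [DecidableEq κ] {s : Finset ι} {t : Finset κ}
    (f : ι → κ) (hf : ∀ a ∈ s, f a ∈ t) (w : κ → ℝ) (hw : ∀ b ∈ t, 0 ≤ w b) {M : ℝ}
    (hM : ∀ b ∈ t, (((s.filter fun a => f a = b).card : ℕ) : ℝ) ≤ M) :
    ∑ a ∈ s, w (f a) ≤ M * ∑ b ∈ t, w b := by
  rw [← sum_fiberwise_of_maps_to' hf w, mul_sum]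
  refine sum_le_sum fun b hb => ?_
  rw [sum_const, nsmul_eq_mul]
  exact mul_le_mul_of_nonneg_right (hM b hb) (hw b hb)

/-! ### Walk anatomy -/

/-- A mid-edge walk list is nonempty. [folklore] -/
theorem kpCount_ne_nil {V : Finset HV} {P : List HV} (h : IsMidWalk V P) : P ≠ [] := by
  obtain ⟨Q, rfl⟩ := h.exists_eq_cons
  exact List.cons_ne_nil _ _

/-- The outer end of the final half-edge is the last entry of the walk list. [folklore] -/
theorem kpCount_getLast? {P : List HV} (h : P ≠ []) : P.getLast? = some (finalDart P).2 := by
  rw [finalDart, List.getLast?_eq_some_getLast h]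
  rfl

/-- A walk of `T_k` to its right side is a mid-edge walk of `T_k`. [cite: KrachunPanagiotis2026, Definition 2.3] -/
theorem kpCount_isMidWalk {k : ℕ} {P : List HV} (hP : P ∈ rightWalks k) : IsMidWalk (triV k) P :=
  mem_midWalks_iff.1 (mem_filter.1 hP).1

/-- The final half-edge of a walk of `T_k` to its right side is the right dart
`((x₀, x₁, false), (x₀, x₁, true))` of its exit cell. [cite: KrachunPanagiotis2026, §3.2 (x ∈ R_{2k+1})] -/
theorem kpCount_finalDart_eq {k : ℕ} {P : List HV} (hP : P ∈ rightWalks k) :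
    finalDart P = (((finalDart P).1.1, (finalDart P).1.2.1, false),
      ((finalDart P).1.1, (finalDart P).1.2.1, true)) := by
  obtain ⟨-, h2, h3⟩ := (mem_filter.1 hP).2
  exact Prod.ext (Prod.ext rfl (Prod.ext rfl h2)) h3

/-! ### Reading off the first piece: the prefix below the line `slev = k ∣ k+1` -/

/-- A walk of `T_k` to its right side has no proper extension which is again such a walk: its outer
end has `slev = k+1`, while all entries but the last of a right walk have `slev ≤ k`.
[cite: KrachunPanagiotis2026, proof of Lemma 3.2 (pre-images of the concatenation)] -/
theorem kpCount_nil_of_append {k : ℕ} {P a : List HV} (hP : P ∈ rightWalks k)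
    (hPa : P ++ a ∈ rightWalks k) : a = [] := by
  by_contra hne
  have hPne := kpCount_ne_nil (kpCount_isMidWalk hP)
  have h1 := (rightWalks_crossings hP).2.2.1
  have h2 := (rightWalks_crossings hPa).2.1 (finalDart P).2 (by
    rw [List.dropLast_append_of_ne_nil hne]
    exact List.mem_append_left _ (List.mem_of_getLast? (kpCount_getLast? hPne)))
  omega

/-- **The first piece is determined by the glued list** (for a fixed `k`): if `P ++ R = P' ++ R'` with
`P, P'` walks of `T_k` to its right side, then `P = P'` and `R = R'`.
[cite: KrachunPanagiotis2026, proof of Lemma 3.2 (pre-images of the concatenation)] -/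
theorem kpCount_prefix_eq {k : ℕ} {P P' R R' : List HV} (hP : P ∈ rightWalks k)
    (hP' : P' ∈ rightWalks k) (h : P ++ R = P' ++ R') : P = P' ∧ R = R' := by
  rcases List.append_eq_append_iff.1 h with ⟨a, rfl, rfl⟩ | ⟨a, rfl, rfl⟩
  · obtain rfl := kpCount_nil_of_append hP hP'
    simp
  · obtain rfl := kpCount_nil_of_append hP' hP
    simp

/-- **The second piece is determined by its placed tail**: two mid-edge walks `w, O, …` whose placed
lists agree after dropping the two placed root vertices are equal (the placement is injective).
[cite: KrachunPanagiotis2026, proof of Lemma 3.2 (pre-images of the concatenation)] -/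
theorem kpCount_piece₂_eq {V V' : Finset HV} {P P' : List HV} (hP : IsMidWalk V P)
    (hP' : IsMidWalk V' P') (φ : hvGraph ≃g hvGraph)
    (h : (P.map φ).drop 2 = (P'.map φ).drop 2) : P = P' := by
  obtain ⟨Q, rfl⟩ := hP.exists_eq_cons
  obtain ⟨Q', rfl⟩ := hP'.exists_eq_cons
  simp only [List.map_cons, List.drop_succ_cons, List.drop_zero] at h
  rw [List.map_injective_iff.2 φ.injective h]

/-! ### Two pre-images with indices `k' ≤ k`: `k'` is a renewal time of the `k`-piece -/

/-- **Other pre-images are renewal times**: if the same list is `P₁ ++ R = P₁' ++ R'` with `P₁` a right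
walk of `T_k`, `P₁'` a right walk of `T_{k'}`, `k' ≤ k`, and the entries of `R'` beyond the line
`slev = k' ∣ k'+1`, then `P₁` crosses that line exactly once: the whole list crosses it once
(`crossCount_append_eq`, `rightWalks_crossings`), the prefix `P₁` at most as often
(`crossCount_le_append`) and at least once (`one_le_crossCount`, from `slev w = 0` to `slev = k+1`).
[cite: KrachunPanagiotis2026, proof of Lemma 3.2 ("any other pre-image corresponds to a renewal time of γ¹")] -/
theorem kpCount_crossCount_eq_one {k k' : ℕ} {P₁ P₁' R R' : List HV} (hP₁ : P₁ ∈ rightWalks k)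
    (hP₁' : P₁' ∈ rightWalks k') (hR' : ∀ v ∈ R', (k' : ℤ) + 1 ≤ slev v)
    (he : P₁ ++ R = P₁' ++ R') (hk : k' ≤ k) : crossCount (k' : ℤ) P₁ = 1 := by
  obtain ⟨c₁', -, s₁', -⟩ := rightWalks_crossings hP₁'
  obtain ⟨-, -, s₁, -⟩ := rightWalks_crossings hP₁
  have W₁ := kpCount_isMidWalk hP₁
  have n₁ := kpCount_ne_nil W₁
  have n₁' := kpCount_ne_nil (kpCount_isMidWalk hP₁')
  have hlast : ∀ v ∈ P₁'.getLast?, (k' : ℤ) + 1 ≤ slev v := by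
    intro v hv
    rw [Option.mem_def, kpCount_getLast? n₁', Option.some_inj] at hv
    subst hv
    omega
  have hG : crossCount (k' : ℤ) (P₁' ++ R') = 1 := by
    rw [crossCount_append_eq _ _ _ hR' hlast, c₁']
  have h2 : crossCount (k' : ℤ) P₁ ≤ 1 := by
    have := crossCount_le_append (k' : ℤ) P₁ R
    rwa [he, hG] at this
  have h3 : 1 ≤ crossCount (k' : ℤ) P₁ := by
    refine one_le_crossCount _ _ W₁.1 ⟨wOut, Option.mem_def.2 W₁.2.1, ?_⟩
      ⟨(finalDart P₁).2, Option.mem_def.2 (kpCount_getLast? n₁), by omega⟩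
    rw [slev_wOut]
    omega
  omega

/-! ### Construction (a) on the pieces of the left-hand side -/

/-- **Construction (a) on a triple `(k, P₁, P₂)` of the left-hand side** (`stub_kp_glueA` with
`N = 32T`, `i = i_h < 5T`, `k < 2T`, the placement `attach x₀ x₁` read off the final dart of `P₁`):
the glued list is a mid-edge walk of `S_{32T+1,32T+1}` whose final dart is the floor half-edge at
offset `k + 1 + y₁`, `y₁ ∈ [0, i_h)`, its length is `ℓ(P₁) + ℓ(P₂)`, and the attached part lies
beyond the line `slev = k ∣ k+1`. [cite: KrachunPanagiotis2026, §3.2 (construction (a))] -/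
theorem kpCount_glueA {T k : ℕ} {P₁ P₂ : List HV} (hk : k < 2 * T) (hP₁ : P₁ ∈ rightWalks k)
    (hg : GoodHt T (htOf P₁)) (hP₂ : P₂ ∈ midWalks (clipV (goodIdx T (htOf P₁)) (htOf P₁)))
    (hc : IsClipDart (htOf P₁) (finalDart P₂)) :
    P₁ ++ (P₂.map (attach (finalDart P₁).1.1 (finalDart P₁).1.2.1)).drop 2 ∈
        midWalks (stripV (32 * T + 1) (32 * T + 1)) ∧
    finalDart (P₁ ++ (P₂.map (attach (finalDart P₁).1.1 (finalDart P₁).1.2.1)).drop 2) =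
      (((k : ℤ) + 1 + (finalDart P₂).1.2.1, 0, false),
        ((k : ℤ) + 1 + (finalDart P₂).1.2.1, -1, true)) ∧
    mwLen (P₁ ++ (P₂.map (attach (finalDart P₁).1.1 (finalDart P₁).1.2.1)).drop 2) =
      mwLen P₁ + mwLen P₂ ∧
    (∀ v ∈ (P₂.map (attach (finalDart P₁).1.1 (finalDart P₁).1.2.1)).drop 2, (k : ℤ) + 1 ≤ slev v) ∧
    0 ≤ (finalDart P₂).1.2.1 ∧ (finalDart P₂).1.2.1 + 1 ≤ (goodIdx T (htOf P₁) : ℤ) ∧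
    goodIdx T (htOf P₁) < 5 * T := by
  have hi := goodIdx_spec hg
  obtain ⟨h1, h2, h3, h4, h5, h6⟩ := stub_kp_glueA k (goodIdx T (htOf P₁)) (32 * T) P₁ P₂ _ _ hP₁
    (kpCount_finalDart_eq hP₁) hP₂ hc (by omega)
  exact ⟨h1, h2, h3, h4, h5, h6, hi.2.1⟩

/-- **Membership in the domain of triples** `(k, P₁, P₂)` of the left-hand side (the iterated
`Finset.sigma`): `k ∈ [T, 2T)`, `P₁` a walk of `T_k` to its right side with at most `renCap k` renewal
times and a good exit height `h`, `P₂` a walk of the clipped triangle `C(i_h, h)` leaving through its cut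
(KP's pairs `(γ¹, γ²) ∈ D^{ren}_{2k+1}(x) × F^B_{2i_x+1,x}`). [cite: KrachunPanagiotis2026, proof of Lemma 3.2 (eq. (9))] -/
theorem kpCount_mem_dom {T k : ℕ} {P₁ P₂ : List HV} :
    (⟨k, P₁, P₂⟩ : Σ _ : ℕ, Σ _ : List HV, List HV) ∈
        (Ico T (2 * T)).sigma (fun k =>
          ((rightWalks k).filter fun P => (renewals k P : ℝ) ≤ renCap k ∧ GoodHt T (htOf P)).sigma
            fun P₁ => (midWalks (clipV (goodIdx T (htOf P₁)) (htOf P₁))).filter fun P =>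
              IsClipDart (htOf P₁) (finalDart P)) ↔
      (T ≤ k ∧ k < 2 * T) ∧ (P₁ ∈ rightWalks k ∧ (renewals k P₁ : ℝ) ≤ renCap k ∧ GoodHt T (htOf P₁)) ∧
        P₂ ∈ midWalks (clipV (goodIdx T (htOf P₁)) (htOf P₁)) ∧ IsClipDart (htOf P₁) (finalDart P₂) := by
  simp only [mem_sigma, mem_filter, mem_Ico]

/-- **The gluing map sends the domain into the target**: the glued list, coded by its offset
`d = k + 1 + y₁ ∈ [T+1, 7T]`, is one of the floor arches of `S_{32T+1,32T+1}` of the right-hand side.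
[cite: KrachunPanagiotis2026, proof of Lemma 3.2 ("contributes to Σ_{ℓ=T}^{7T} G_ℓ")] -/
theorem kpCount_mapsTo {T k : ℕ} {P₁ P₂ : List HV} (hTk : T ≤ k) (hk : k < 2 * T)
    (hP₁ : P₁ ∈ rightWalks k) (hg : GoodHt T (htOf P₁))
    (hP₂ : P₂ ∈ midWalks (clipV (goodIdx T (htOf P₁)) (htOf P₁)))
    (hc : IsClipDart (htOf P₁) (finalDart P₂)) :
    (⟨(k : ℤ) + 1 + (finalDart P₂).1.2.1,
        P₁ ++ (P₂.map (attach (finalDart P₁).1.1 (finalDart P₁).1.2.1)).drop 2⟩ : Σ _ : ℤ, List HV) ∈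
      (Icc ((T : ℤ) + 1) (7 * T)).sigma (fun d =>
        (midWalks (stripV (32 * T + 1) (32 * T + 1))).filter fun P =>
          finalDart P = ((d, 0, false), (d, -1, true)) ∨ finalDart P = ((d, -1, true), (d, 0, false))) := by
  obtain ⟨h1, h2, -, -, h5, h6, h7⟩ := kpCount_glueA hk hP₁ hg hP₂ hc
  simp only [mem_sigma, mem_Icc, mem_filter]
  exact ⟨⟨by omega, by omega⟩, h1, Or.inl h2⟩

/-! ### The fibres of the gluing map -/

/-- `M_k ≥ 0` (a quotient of nonnegative partition functions). [cite: KrachunPanagiotis2026, §3.2 (M_k)] -/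
theorem kpCount_renCap_nonneg (k : ℕ) : 0 ≤ renCap k := by
  rw [renCap, renBound]
  refine div_nonneg (mul_nonneg (by norm_num) (sum_nonneg fun i _ => ?_)) (triDr_nonneg k)
  exact mul_nonneg (mul_nonneg zero_le_two (triDl_nonneg i))
    (mul_nonneg (mul_nonneg zero_le_two cos_pi_div_eight_pos.le) (triDl_nonneg _))

/-- **The fibre bound**: a set `F` of triples of the domain with one and the same glued list `G` has at
most `M` elements.  Take `(k, P₁, P₂) ∈ F` with `k` maximal; then `(k', P₁', P₂') ↦ k'` is injective on
`F` (`kpCount_prefix_eq`, `kpCount_piece₂_eq`) with values among the renewal times of `P₁`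
(`kpCount_crossCount_eq_one`), whose number is at most `renCap k ≤ M`.
[cite: KrachunPanagiotis2026, proof of Lemma 3.2 ("the number of renewal times of γ¹ is at most M_k")] -/
theorem kpCount_fibre_le {T : ℕ} (hT : 1 ≤ T) {M : ℝ}
    (hM : ∀ k : ℕ, T ≤ k → k < 2 * T → renCap k ≤ M)
    (F : Finset (Σ _ : ℕ, Σ _ : List HV, List HV)) (G : List HV)
    (hF : ∀ {k : ℕ} {P₁ P₂ : List HV}, (⟨k, P₁, P₂⟩ : Σ _ : ℕ, Σ _ : List HV, List HV) ∈ F →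
      ((T ≤ k ∧ k < 2 * T) ∧ (P₁ ∈ rightWalks k ∧ (renewals k P₁ : ℝ) ≤ renCap k ∧ GoodHt T (htOf P₁)) ∧
        P₂ ∈ midWalks (clipV (goodIdx T (htOf P₁)) (htOf P₁)) ∧ IsClipDart (htOf P₁) (finalDart P₂)) ∧
      P₁ ++ (P₂.map (attach (finalDart P₁).1.1 (finalDart P₁).1.2.1)).drop 2 = G) :
    ((F.card : ℕ) : ℝ) ≤ M := by
  rcases F.eq_empty_or_nonempty with rfl | hne
  · rw [card_empty, Nat.cast_zero]
    exact (kpCount_renCap_nonneg T).trans (hM T le_rfl (by omega))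
  obtain ⟨⟨k, P₁, P₂⟩, haF, hmax⟩ := exists_max_image F (fun a => a.1) hne
  obtain ⟨⟨⟨hTk, hk2⟩, ⟨hP₁, hren, -⟩, -, -⟩, haG⟩ := hF haF
  have hcard : F.card ≤ renewals k P₁ := by
    unfold renewals
    refine card_le_card_of_injOn (fun b => b.1) ?_ ?_
    · rintro ⟨k', Q₁, Q₂⟩ hbF
      have hle : k' ≤ k := hmax _ (mem_coe.1 hbF)
      obtain ⟨⟨⟨-, hk'⟩, ⟨hQ₁, -, hg⟩, hQ₂, hc⟩, hbG⟩ := hF (mem_coe.1 hbF)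
      rw [mem_coe, mem_filter, mem_range]
      exact ⟨Nat.lt_succ_of_le hle, kpCount_crossCount_eq_one hP₁ hQ₁
        (kpCount_glueA hk' hQ₁ hg hQ₂ hc).2.2.2.1 (haG.trans hbG.symm) hle⟩
    · rintro ⟨k₁, Q₁, Q₂⟩ h₁ ⟨k₂, R₁, R₂⟩ h₂ h12
      obtain ⟨⟨-, ⟨hQ₁, -, -⟩, hQ₂, -⟩, hG₁⟩ := hF (mem_coe.1 h₁)
      obtain ⟨⟨-, ⟨hR₁, -, -⟩, hR₂, -⟩, hG₂⟩ := hF (mem_coe.1 h₂)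
      have hk : k₁ = k₂ := h12
      subst hk
      obtain ⟨rfl, hR⟩ := kpCount_prefix_eq hQ₁ hR₁ (hG₁.trans hG₂.symm)
      rw [kpCount_piece₂_eq (mem_midWalks_iff.1 hQ₂) (mem_midWalks_iff.1 hR₂) _ hR]
  calc ((F.card : ℕ) : ℝ) ≤ renewals k P₁ := by exact_mod_cast hcard
    _ ≤ renCap k := hren
    _ ≤ M := hM k hTk hk2

/-! ### The left-hand side as a weighted count of glued lists -/

/-- The left-hand side of Lemma 3.2 (a) as the weighted count of the glued lists over the domain of
triples (unfold `clipE = F^B`, distribute, merge the iterated sums into a `Finset.sigma`, lengths add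
under gluing). [cite: KrachunPanagiotis2026, proof of Lemma 3.2 (eq. (9), left side)] -/
theorem kpCount_lhs_eq (T : ℕ) :
    ∑ k ∈ Finset.Ico T (2 * T), ∑ P ∈ (rightWalks k).filter
        (fun P => (renewals k P : ℝ) ≤ renCap k ∧ GoodHt T (htOf P)),
      hexCriticalFugacity ^ mwLen P * clipE (goodIdx T (htOf P)) (htOf P) =
    ∑ a ∈ (Ico T (2 * T)).sigma (fun k =>
          ((rightWalks k).filter fun P => (renewals k P : ℝ) ≤ renCap k ∧ GoodHt T (htOf P)).sigma
            fun P₁ => (midWalks (clipV (goodIdx T (htOf P₁)) (htOf P₁))).filter fun P =>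
              IsClipDart (htOf P₁) (finalDart P)),
      hexCriticalFugacity ^
        mwLen (a.2.1 ++ (a.2.2.map (attach (finalDart a.2.1).1.1 (finalDart a.2.1).1.2.1)).drop 2) := by
  rw [sum_sigma]
  refine sum_congr rfl fun k hk => ?_
  rw [sum_sigma]
  refine sum_congr rfl fun P₁ hP₁ => ?_
  rw [clipE, mul_sum]
  refine sum_congr rfl fun P₂ hP₂ => ?_
  obtain ⟨hP₁', -, hg⟩ := mem_filter.1 hP₁
  obtain ⟨hP₂', hc⟩ := mem_filter.1 hP₂
  rw [← pow_add, (kpCount_glueA (mem_Ico.1 hk).2 hP₁' hg hP₂' hc).2.2.1]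

/-! ### The registered sub-goal -/

/-- **Registered sub-goal `stub_kp_countA`** (crux item stmt-CriticalPhenomena-0808, line
`root-locality-replaces-loewner`) — **Krachun–Panagiotis, Lemma 3.2, the counting step of
construction (a)**: the `x_c`-mass of the pairs (right walk of `T_k` with at most `renCap k ≤ M` renewal
times and a good exit height `h`, cut exit of the clipped triangle `C(i_h, h)`), summed over
`k ∈ [T, 2T)`, is at most `(1 + M)` times the coded floor-arch mass of the trapezoid `S_{32T+1,32T+1}`
at offsets `d ∈ [T+1, 7T]`: construction (a) glues each pair into such an arch with the weights
multiplying, and each arch has at most `M` pre-images (renewal-time argument).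
[cite: KrachunPanagiotis2026, Lemma 3.2 (eq. (9))] -/
theorem stub_kp_countA : ∀ (T : ℕ), 1 ≤ T → ∀ (M : ℝ), (∀ k : ℕ, T ≤ k → k < 2 * T → renCap k ≤ M) → ∑ k ∈ Finset.Ico T (2 * T), ∑ P ∈ (rightWalks k).filter (fun P => (renewals k P : ℝ) ≤ renCap k ∧ GoodHt T (htOf P)), Literature.Probability.RandomPlanarGeometry.SAW.hexCriticalFugacity ^ Literature.Probability.RandomPlanarGeometry.SAW.HV.mwLen P * clipE (goodIdx T (htOf P)) (htOf P) ≤ (1 + M) * ∑ d ∈ Finset.Icc ((T : ℤ) + 1) (7 * T), ∑ P ∈ (Literature.Probability.RandomPlanarGeometry.SAW.HV.midWalks (Literature.Probability.RandomPlanarGeometry.SAW.HV.stripV (32 * T + 1) (32 * T + 1))).filter (fun P => Literature.Probability.RandomPlanarGeometry.SAW.HV.finalDart P = ((d, 0, false), (d, -1, true)) ∨ Literature.Probability.RandomPlanarGeometry.SAW.HV.finalDart P = ((d, -1, true), (d, 0, false))), Literature.Probability.RandomPlanarGeometry.SAW.hexCriticalFugacity ^ Literature.Probability.RandomPlanarGeometry.SAW.HV.mwLen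 P := by
  intro T hT M hM
  rw [kpCount_lhs_eq T, sum_sigma']
  refine le_trans ?_ (mul_le_mul_of_nonneg_right (show M ≤ 1 + M by linarith)
    (sum_nonneg fun _ _ => pow_nonneg hexCriticalFugacity_pos_lt_one.1.le _))
  refine kpCount_sum_le_mul_sum
    (fun a : (Σ _ : ℕ, Σ _ : List HV, List HV) => (⟨(a.1 : ℤ) + 1 + (finalDart a.2.2).1.2.1,
      a.2.1 ++ (a.2.2.map (attach (finalDart a.2.1).1.1 (finalDart a.2.1).1.2.1)).drop 2⟩ :
        Σ _ : ℤ, List HV))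
    ?_ (fun b => hexCriticalFugacity ^ mwLen b.2)
    (fun _ _ => pow_nonneg hexCriticalFugacity_pos_lt_one.1.le _) ?_
  · rintro ⟨k, P₁, P₂⟩ ha
    obtain ⟨⟨hTk, hk⟩, ⟨hP₁, -, hg⟩, hP₂, hc⟩ := kpCount_mem_dom.1 ha
    exact kpCount_mapsTo hTk hk hP₁ hg hP₂ hc
  · rintro ⟨d, G⟩ -
    exact kpCount_fibre_le hT hM _ G fun h =>
      ⟨kpCount_mem_dom.1 (mem_filter.1 h).1, eq_of_heq (Sigma.mk.inj_iff.1 (mem_filter.1 h).2).2⟩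

end Summit.CriticalPhenomena.SAWScalingLimit.Theorems.HexConjecture.RootLocality

end
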